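import Mathlib
import HarnessLib
import Summits.SmoothPoincare4.SmoothPoincare4.Theses.WeakReductionDescent
import Literature.Topology.FourManifolds.WeaklyReducibleTrisections
import Literature.Topology.FourManifolds.ReducibleTrisectionSplitting
import Literature.Topology.FourManifolds.HomotopySphereSummands
import Literature.Topology.FourManifolds.HomotopySphereSummandsProofs
import Literature.Topology.FourManifolds.ConnectedSumSummands
import Literature.Topology.FourManifolds.HomotopyS4CompactProofs
import Literature.Topology.FourManifolds.HomotopyS4OrientableProofs
import Literature.Topology.FourManifolds.SphereSimplyConnected
import Literature.Geometry.Riemannian.TwoConvexSchoenfliesProofs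

/-!
# SmoothPoincare4 / WeakReductionDescent — `ReducibleSplits` from the printed splitting of
# reducible trisections

Item stmt-SmoothPoincare4-17909 (support `ReducibleSplits` of route WeakReductionDescent): a
GK-trisection of genus `g` of a smooth homotopy 4-sphere `M` which is reducible along an
essential curve `δ` exhibits `M` as a connected sum `A # B` of two smooth homotopy 4-spheres
carrying GK-trisections of genera `< g`.

This file proves the item CONDITIONALLY (`reducibleSplits_of_facts`), from
* the two named facts of `Literature/Topology/FourManifolds/ReducibleTrisectionSplitting.lean`
  (Aranda–Zupan 2025, §2 p. 6, after Gay–Kirby 2016 §2): a trisection with a SEPARATING reducing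
  curve is a connected sum `T = T′ # T″` of trisections of `X′ # X″ = X` with genera
  `g′ + g″ = g`, `g′, g″ ≥ 1` (`Trisection.isConnectedSum_of_reducing_separating`); with a
  NON-SEPARATING reducing curve `X = X′ # (S¹ × S³)`
  (`Trisection.isConnectedSum_circleProd_of_reducing_nonseparating`);
* the tree's characterisation of homotopy 4-spheres `nonempty_homotopyEquiv_sphere_four_iff`
  (`SPC4Wave0.lean`, spc4.S10: `π₁ = 1` and `H₂ = 0`), through the PROVED
  `nonempty_homotopyEquiv_sphere_four_left_of_isConnectedSum_of_iff`
  (`HomotopySphereSummandsProofs.lean`, Kosinski 1993 VI Prop. 2.1: a summand of a homotopy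
  4-sphere is a homotopy 4-sphere);
and, in `reducibleSplits_of_textbook_facts`, from the first two plus Poincaré duality,
Whitehead's theorem and the CW type of compact manifolds (the named facts behind spc4.S10);
`reducibleSplits_of_splitting_of_kosinski` takes instead Kosinski's Prop. VI.2.1 itself (the
named fact `nonempty_homotopyEquiv_sphere_four_left_of_isConnectedSum`,
`HomotopySphereSummands.lean`).

Proof: `M ≃ₕ S⁴` is compact (`compactSpace_of_homotopyEquiv_sphere_four_holds`), simply
connected (`simplyConnectedSpace_sphere_four_holds`), hence connected, and orientable
(`isOrientable_of_homotopyEquiv_sphere_four_holds`).  If the reducing curve `δ` were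
non-separating, `M = X′ # (S¹ × S³)` and the proved `IsConnectedSum.simplyConnectedSpace_right`
would make `S¹ × S³` simply connected, contradicting the proved
`not_simplyConnectedSpace_of_homotopyEquiv_sphere_prod_circle`.  So `δ` separates,
`M = A # B` with trisections of genera `g₁, g₂ ≥ 1`, `g₁ + g₂ = g` (hence `< g`), and `A`, `B`
are homotopy 4-spheres as summands of one.

Nothing here uses `sorry`; the named facts are hypotheses of the final theorems (the item
stays open until `Trisection.isConnectedSum_of_reducing_separating`,
`Trisection.isConnectedSum_circleProd_of_reducing_nonseparating` and spc4.S10 are discharged).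
-/

open scoped Manifold ContDiff Topology ContinuousMap
open Set Function

-- the prescribed namespace `Summit.<P>.<Sub>.Theorems` duplicates `SmoothPoincare4` (P = Sub)
set_option linter.dupNamespace false

namespace Summit.SmoothPoincare4.SmoothPoincare4.Theorems

open Literature.Topology.FourManifolds

/-- `S¹ × S³` (Mathlib's `Circle × 𝕊³`) is not simply connected: swap the factors and apply the
tree's `not_simplyConnectedSpace_of_homotopyEquiv_sphere_prod_circle` (`π₁(S¹) ≠ 1` by real
lifts of circle-valued maps). [folklore] -/
theorem not_simplyConnectedSpace_circle_prod_sphere_three :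
    ¬ SimplyConnectedSpace (Circle × (Metric.sphere (0 : EuclideanSpace ℝ (Fin 4)) 1)) :=
  Literature.Geometry.Riemannian.not_simplyConnectedSpace_of_homotopyEquiv_sphere_prod_circle
    (n := 4) (by norm_num)
    (Homeomorph.prodComm Circle (Metric.sphere (0 : EuclideanSpace ℝ (Fin 4)) 1)).toHomotopyEquiv

/-- **`ReducibleSplits` from the splitting facts and a summand principle** (item
stmt-SmoothPoincare4-17909, conditional): if reducible trisections split as printed
(Aranda–Zupan 2025 §2 p. 6, both cases) and summands of homotopy 4-spheres are homotopy
4-spheres (the body of Kosinski's Prop. VI.2.1, "only if", `m = 4`, at universe `0`, taken here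
as a hypothesis `hsum`), then
`Summit.SmoothPoincare4.SmoothPoincare4.Theses.WeakReductionDescent.ReducibleSplits` holds.
The non-separating case is excluded because `M ≃ₕ S⁴` is simply connected while `S¹ × S³` is
not (`IsConnectedSum.simplyConnectedSpace_right`, proved in the tree). [folklore] -/
theorem reducibleSplits_of_splitting_of_summands
    (h1a : Trisection.isConnectedSum_of_reducing_separating.{0})
    (h1b : Trisection.isConnectedSum_circleProd_of_reducing_nonseparating.{0})
    (hsum : ∀ (A : Type) [TopologicalSpace A] [T2Space A] [SecondCountableTopology A]
      [ChartedSpace (EuclideanSpace ℝ (Fin 4)) A] [IsManifold (𝓡 4) ∞ A] [CompactSpace A]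
      [ConnectedSpace A]
      (B : Type) [TopologicalSpace B] [T2Space B] [SecondCountableTopology B]
      [ChartedSpace (EuclideanSpace ℝ (Fin 4)) B] [IsManifold (𝓡 4) ∞ B] [CompactSpace B]
      [ConnectedSpace B]
      (P : Type) [TopologicalSpace P] [T2Space P] [SecondCountableTopology P]
      [ChartedSpace (EuclideanSpace ℝ (Fin 4)) P] [IsManifold (𝓡 4) ∞ P],
      IsConnectedSum (𝓡 4) (𝓡 4) (𝓡 4) A B P →
      P ≃ₕ (Metric.sphere (0 : EuclideanSpace ℝ (Fin 5)) 1) →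
      Nonempty (A ≃ₕ (Metric.sphere (0 : EuclideanSpace ℝ (Fin 5)) 1))) :
    Summit.SmoothPoincare4.SmoothPoincare4.Theses.WeakReductionDescent.ReducibleSplits := by
  unfold Summit.SmoothPoincare4.SmoothPoincare4.Theses.WeakReductionDescent.ReducibleSplits
  intro M _ _ _ _ _ e g k T hT hred
  -- the homotopy 4-sphere `M` is compact, simply connected (hence connected) and orientable
  haveI : CompactSpace M := compactSpace_of_homotopyEquiv_sphere_four_holds M e
  haveI : SimplyConnectedSpace M :=
    e.simplyConnectedSpace_iff.2 simplyConnectedSpace_sphere_four_holds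
  haveI : ConnectedSpace M := inferInstance
  obtain ⟨o⟩ := isOrientable_of_homotopyEquiv_sphere_four_holds M e
  -- the reducing curve
  have hred' : Trisection.IsReducible T := hred
  obtain ⟨δ, hcurve, hess, hdiscs⟩ := hred'
  by_cases hsep : Trisection.IsNonSeparating T δ
  · -- non-separating: `M = X₁ # (S¹ × S³)` would make `S¹ × S³` simply connected
    obtain ⟨X₁, _, _, _, _, _, _, _, g₁, k₁, S₁, -, -, -, hP⟩ :=
      h1b M o g k T δ hT hcurve hess hdiscs hsep
    have h4 : 1 < Module.finrank ℝ (EuclideanSpace ℝ (Fin 4)) := by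
      rw [finrank_euclideanSpace_fin]; norm_num
    exact absurd (hP.simplyConnectedSpace_right h4)
      not_simplyConnectedSpace_circle_prod_sphere_three
  · -- separating: `M = A # B` with trisections of genera `g₁, g₂ ≥ 1`, `g₁ + g₂ = g`
    obtain ⟨A, _, _, _, _, _, _, _, B, _, _, _, _, _, _, _, ga, gb, ka, kb, TA, TB, hA, hB,
      hsumg, hga, hgb, -, hP⟩ := h1a M o g k T δ hT hcurve hess hdiscs hsep
    obtain ⟨eA⟩ := hsum A B M hP e
    obtain ⟨eB⟩ := hsum B A M hP.symm e
    exact ⟨A, inferInstance, inferInstance, inferInstance, inferInstance, inferInstance, eA,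
      B, inferInstance, inferInstance, inferInstance, inferInstance, inferInstance, eB,
      ga, gb, ka, kb, TA, TB, hA, hB, by omega, by omega, hP⟩

/-- **`ReducibleSplits` from the two splitting facts and Kosinski's Prop. VI.2.1** (item
stmt-SmoothPoincare4-17909, conditional on the three named facts
`Trisection.isConnectedSum_of_reducing_separating`,
`Trisection.isConnectedSum_circleProd_of_reducing_nonseparating` (Aranda–Zupan 2025 §2 p. 6) and
`nonempty_homotopyEquiv_sphere_four_left_of_isConnectedSum` (Kosinski 1993 VI Prop. 2.1, only
if, `m = 4`; itself proved in the tree modulo spc4.S10,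
`nonempty_homotopyEquiv_sphere_four_left_of_isConnectedSum_of_iff`). [folklore] -/
theorem reducibleSplits_of_splitting_of_kosinski
    (h1a : Trisection.isConnectedSum_of_reducing_separating.{0})
    (h1b : Trisection.isConnectedSum_circleProd_of_reducing_nonseparating.{0})
    (h2 : nonempty_homotopyEquiv_sphere_four_left_of_isConnectedSum.{0}) :
    Summit.SmoothPoincare4.SmoothPoincare4.Theses.WeakReductionDescent.ReducibleSplits :=
  reducibleSplits_of_splitting_of_summands h1a h1b h2

/-- **`ReducibleSplits` from the two splitting facts and the characterisation of homotopy
4-spheres** (item stmt-SmoothPoincare4-17909, conditional on three named facts of the tree: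
`Trisection.isConnectedSum_of_reducing_separating`,
`Trisection.isConnectedSum_circleProd_of_reducing_nonseparating` (Aranda–Zupan 2025 §2 p. 6) and
`nonempty_homotopyEquiv_sphere_four_iff` (spc4.S10, Freedman–Quinn 1990 §10.1), the last through
the proved `nonempty_homotopyEquiv_sphere_four_left_of_isConnectedSum_of_iff`, Kosinski 1993
VI Prop. 2.1). [folklore] -/
theorem reducibleSplits_of_facts
    (h1a : Trisection.isConnectedSum_of_reducing_separating.{0})
    (h1b : Trisection.isConnectedSum_circleProd_of_reducing_nonseparating.{0})
    (hS10 : nonempty_homotopyEquiv_sphere_four_iff.{0}) :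
    Summit.SmoothPoincare4.SmoothPoincare4.Theses.WeakReductionDescent.ReducibleSplits :=
  reducibleSplits_of_splitting_of_summands h1a h1b
    (nonempty_homotopyEquiv_sphere_four_left_of_isConnectedSum_of_iff hS10)

/-- **`ReducibleSplits` from the two splitting facts and the textbook facts of algebraic
topology** (item stmt-SmoothPoincare4-17909, conditional): Poincaré duality (`hPD`, Hatcher
Thm. 3.30), Whitehead's theorem (`hW`, Cor. 4.33) and the CW homotopy type of compact manifolds
(`hCW`, Cor. A.12) replace spc4.S10 (`nonempty_homotopyEquiv_sphere_four_iff_of_facts`).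
[folklore] -/
theorem reducibleSplits_of_textbook_facts
    (h1a : Trisection.isConnectedSum_of_reducing_separating.{0})
    (h1b : Trisection.isConnectedSum_circleProd_of_reducing_nonseparating.{0})
    (hPD : ∀ (M : Type) [TopologicalSpace M] [CompactSpace M] [T2Space M]
      [ChartedSpace (EuclideanSpace ℝ (Fin 4)) M]
      (μ : Literature.AlgebraicTopology.SingularHomology.HomologicalOrientation ℤ M 4),
      Literature.AlgebraicTopology.SingularHomology.bijective_poincareDualityMap μ (Nat.add_comm 1 3))
    (hW : Literature.AlgebraicTopology.Homotopy.whitehead_exists_homotopyEquiv.{0})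
    (hCW : Literature.AlgebraicTopology.Homotopy.exists_cwComplex_homotopyEquiv_of_compactSpace.{0}) :
    Summit.SmoothPoincare4.SmoothPoincare4.Theses.WeakReductionDescent.ReducibleSplits :=
  reducibleSplits_of_splitting_of_summands h1a h1b
    (nonempty_homotopyEquiv_sphere_four_left_of_isConnectedSum_of_facts hPD hW hCW)

end Summit.SmoothPoincare4.SmoothPoincare4.Theorems
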